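import Literature.AlgebraicGeometry.AbelianSchemes.AbelianSchemeDualTransport
import Literature.AlgebraicGeometry.AbelianSchemes.AbelianSchemeOverHomNoetherian
import HarnessLib

/-!
# The dual transport `Ĥ_e : Â' ≅ Â` is a HOMOMORPHISM over any connected locally Noetherian base — clause (ii) of
# [MumfordFogartyKirwan1994, Ch. 7 §2 Def. 7.3] along `𝟙 S` without the field hypothesis (uniqueness of dual pairs as group schemes)

[MilneAV2008, I §8 pp. 36–37]: the dual pair `(A^∨, 𝒫)` is unique up to a unique isomorphism, by its universal property;
[MumfordFogartyKirwan1994, Ch. 6 §1 Cor. 6.4 (p. 117)]: a unit-preserving `S`-morphism of abelian schemes over a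
connected base is a homomorphism.  The tree's ★ `AbelianSchemeDualTransport` (W3c) builds, for an isomorphism of
`S`-group schemes `e : A'.X ≅ A.X` and dual pairs `D` of `A`, `D'` of `A'` (★ D2 `DualPair`), the transport
`hatTransport D D' e : Â' → Â` over `S` with its Poincaré clause `(e × Ĥ_e)^*𝒫 ≅ 𝒫'`, proves it an isomorphism
(`isIso_hatTransportOver`), unique (★ `AbelianSchemeDualTransportUnique`) and unit-preserving under the unit hypotheses
`hD`, `hD'` (`one_comp_hatTransportOver`) — over ANY base; but its last two heads, `isMonHom_hatTransportOver` («`Ĥ_e` is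
a homomorphism») and the packaged clause (ii) `hat_isBaseChangeVia_id_hatTransport`, are typed over a FIELD `K` only,
because they use rigidity over a field.  THIS FILE removes that restriction with the Stein rigidity of ★
`AbelianSchemeOverHomNoetherian.isMonHom_of_one_comp_of_isLocallyNoetherian` ([MFK94] Cor. 6.4 over a connected locally
Noetherian base, no reducedness):

* `DualPair.isMonHom_hatTransportOver_of_isLocallyNoetherian` — `Ĥ_e` is a homomorphism of `S`-group schemes,
  `S` locally Noetherian and preconnected;
* `DualPair.hat_isBaseChangeVia_id_hatTransport_of_isLocallyNoetherian` — clause (ii): `Â'` is the base change of `Â`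
  along `𝟙 S` via `Ĥ_e` AS GROUP SCHEMES (★ `isBaseChangeVia_id_of_isMonHom`);
* `DualPair.exists_hat_isBaseChangeVia_id_of_isLocallyNoetherian` — the ∃-packaged form a consumer reads: two dual pairs
  of isomorphic abelian schemes over a connected locally Noetherian base have duals identified AS GROUP SCHEMES over `𝟙 S`
  by a map carrying `𝒫` to `𝒫'` (take `e` an identity-shaped iso for two dual pairs of the SAME `A`).

Theorems only; no named fact, no `sorry`, no instance, no notation.  Cell hodgecm-mathlib, F-DAG sub-hand of (h7)(D)
(B-p14 (g16) census `CENSUS-h7-TripleLayer` road (D-F3): the triple over a glued base takes its dual pair from F-3 and needs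
dual pairs unique up to unique GROUP-SCHEME isomorphism over a non-field base).  HC_CM is proved only modulo the printed
citations until rung 0 closes; this file discharges none of them.

## References
* [MilneAV2008] J. S. Milne, *Abelian Varieties* (2008), I §8 pp. 36–37 (uniqueness of the dual pair).
* [MumfordFogartyKirwan1994] D. Mumford, J. Fogarty, F. Kirwan, *Geometric Invariant Theory*, 3rd ed., Springer 1994,
  Ch. 6 §1 Cor. 6.4 (p. 117); Ch. 7 §2 Def. 7.3 (p. 129) (clauses (ii)+(iii) of an isomorphism of triples).
-/

noncomputable section

universe u

open CategoryTheory CategoryTheory.Limits AlgebraicGeometry MonoidalCategory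
open scoped MonObj

namespace Literature.AlgebraicGeometry.AbelianSchemes

namespace AbelianSchemeOver

namespace DualPair

variable {S : Scheme.{u}} {A A' : AbelianSchemeOver S} (D : A.DualPair) (D' : A'.DualPair)
  (e : A'.X ≅ A.X) [IsMonHom e.hom]

/-- **`Ĥ_e` IS A HOMOMORPHISM of `S`-group schemes over a connected locally Noetherian base** — [MumfordFogartyKirwan1994]
Cor. 6.4 in its Stein form (★ `isMonHom_of_one_comp_of_isLocallyNoetherian`, no field, no reducedness) applied to
`Ĥ_e : Â' → Â` and `ε_{Â'} ≫ Ĥ_e = ε_Â` (★ `one_comp_hatTransportOver`, under the unit hypotheses `hD`, `hD'`, which hold for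
polarised abelian schemes ★ `AbelianSchemeDualTransportUnit`). [cite: MumfordFogartyKirwan1994, Ch. 6 §1 Corollary 6.4 (p. 117)]
[cite: MilneAV2008, I §8 pp. 36–37] -/
theorem isMonHom_hatTransportOver_of_isLocallyNoetherian [IsLocallyNoetherian S] [PreconnectedSpace S]
    (hD : Nonempty ((Scheme.Modules.pullback (unitHatSlice D)).obj D.P ≅ SheafOfModules.unit _))
    (hD' : Nonempty ((Scheme.Modules.pullback (unitHatSlice D')).obj D'.P ≅ SheafOfModules.unit _)) :
    IsMonHom (hatTransportOver D D' e) :=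
  isMonHom_of_one_comp_of_isLocallyNoetherian (A := D'.hat) (B := D.hat) (hatTransportOver D D' e)
    (one_comp_hatTransportOver D D' e hD hD')

/-- **CLAUSE (ii) OF [MFK94] Def. 7.3 ALONG `𝟙 S` FOR `(e, Ĥ_e)` over a connected locally Noetherian base**: `Â'` is the
base change of `Â` along `𝟙 S` via `Ĥ_e` AS GROUP SCHEMES (`AbelianSchemeOver.IsBaseChangeVia`: cartesian square + unit +
multiplication) — `isMonHom_hatTransportOver_of_isLocallyNoetherian` + ★ `isIso_hatTransportOver` + ★
`isBaseChangeVia_id_of_isMonHom`.  The inverse isomorphism `e'` is passed with `e'.hom = e.inv` as in ★ `hatTransportIso`.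
[cite: MumfordFogartyKirwan1994, Ch. 7 §2 Definition 7.3 (p. 129)] [cite: MilneAV2008, I §8 pp. 36–37] -/
theorem hat_isBaseChangeVia_id_hatTransport_of_isLocallyNoetherian [IsLocallyNoetherian S] [PreconnectedSpace S]
    (e' : A.X ≅ A'.X) [IsMonHom e'.hom] (he' : e'.hom = e.inv)
    (hD : Nonempty ((Scheme.Modules.pullback (unitHatSlice D)).obj D.P ≅ SheafOfModules.unit _))
    (hD' : Nonempty ((Scheme.Modules.pullback (unitHatSlice D')).obj D'.P ≅ SheafOfModules.unit _)) :
    D'.hat.IsBaseChangeVia D.hat (𝟙 S) (hatTransport D D' e) := by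
  haveI := isIso_hatTransportOver D D' e e' he'
  haveI := isMonHom_hatTransportOver_of_isLocallyNoetherian D D' e hD hD'
  exact isBaseChangeVia_id_of_isMonHom D'.hat D.hat (hatTransportOver D D' e)

/-- **UNIQUENESS OF THE DUAL PAIR AS A GROUP SCHEME, ∃-packaged** (the consumer's form): over a connected locally
Noetherian base, for an isomorphism of `S`-group schemes `e : A' ≅ A` (with an inverse `e'`) and dual pairs `D`, `D'` of
`A`, `A'` satisfying the unit hypotheses, there is `Ĥ : Â' → Â` exhibiting `Â'` as the base change of `Â` along `𝟙 S`
AS GROUP SCHEMES and carrying the Poincaré module: `(e × Ĥ)^*𝒫 ≅ 𝒫'` — clauses (ii)+(iii) of an isomorphism of triples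
along `𝟙 S`.  For two dual pairs of the SAME `A` take `A' = A` and any identity-shaped `e`.
[cite: MilneAV2008, I §8 pp. 36–37] [cite: MumfordFogartyKirwan1994, Ch. 7 §2 Definition 7.3 (p. 129)] -/
theorem exists_hat_isBaseChangeVia_id_of_isLocallyNoetherian [IsLocallyNoetherian S] [PreconnectedSpace S]
    (e' : A.X ≅ A'.X) [IsMonHom e'.hom] (he' : e'.hom = e.inv)
    (hD : Nonempty ((Scheme.Modules.pullback (unitHatSlice D)).obj D.P ≅ SheafOfModules.unit _))
    (hD' : Nonempty ((Scheme.Modules.pullback (unitHatSlice D')).obj D'.P ≅ SheafOfModules.unit _)) :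
    ∃ (Ĥ : D'.hat.X.left ⟶ D.hat.X.left) (wĤ : Ĥ ≫ D.hat.X.hom = D'.hat.X.hom),
      D'.hat.IsBaseChangeVia D.hat (𝟙 S) Ĥ ∧
        Nonempty ((Scheme.Modules.pullback
          (pullback.map A'.X.hom D'.hat.X.hom A.X.hom D.hat.X.hom e.hom.left Ĥ (𝟙 S)
            (by rw [Category.comp_id, Over.w]) (by rw [Category.comp_id, wĤ]))).obj D.P ≅ D'.P) :=
  ⟨hatTransport D D' e, hatTransport_comp_hom D D' e,
    hat_isBaseChangeVia_id_hatTransport_of_isLocallyNoetherian D D' e e' he' hD hD',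
    nonempty_pullback_map_hatTransport_iso D D' e⟩

end DualPair

end AbelianSchemeOver

end Literature.AlgebraicGeometry.AbelianSchemes

end
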